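import Mathlib.FieldTheory.Finite.Basic
import Literature.LinearAlgebra.Matrix.PermanentModTwoPowSteps
import HarnessLib

/-!
# The permanent modulo `2^k` in polynomial time, III: correctness of Valiant's elimination

L. G. Valiant, *The complexity of computing the permanent*, TCS 8 (1979), Thm. 3. Second half of
the correctness proof of the list program `PermMod2.pm` (`PermanentModTwoPowAlgorithm.lean`; the
single step is `PermanentModTwoPowSteps.perm_elim_step`):

* **`PermMod2.pm_rows : pm K (rows M) = M.permanent % 2 ^ K`** for every square matrix `M` of
  natural numbers (`rows` = `Berkowitz.rows`), and the list-level form `PermMod2.pm_spec` on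
  well-formed square list matrices.

Following Valiant (pp. 198–199), as congruences modulo `2^(K+1)` given level `K`:
* §F the loop (`elim_spec`): the eliminated rows start with `0` (`headD_addRow_eq_zero`, Euler's
  `c · c^(2^K - 1) ≡ 1 (mod 2^(K+1))` for odd `c`, `mul_oddInv_mod`), and `perm + corr` is invariant;
* §G Laplace at the cleared column (`perm_cons_of_heads0`) and the all-even column
  (`perm_even_column`, where the factor `2` lets the minors be taken modulo `2^K`);
* §H one stage preserves `μ·perm(B) + acc` and shrinks `B` (`stage_spec`; moving the pivot row to
  the front is a row permutation, `Matrix.permanent_permute_cols`);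
* §I all stages exhaust the matrix (`stages_spec`); induction on `K` (`pm_spec`, `pm_rows`).

## References

* [Valiant1979] L. G. Valiant, *The complexity of computing the permanent*, Theoret. Comput. Sci.
  8 (1979) 189–201, Thm. 3 and its proof (pp. 198–199).
-/

namespace Literature.LinearAlgebra.Matrix

namespace PermMod2

open Finset

/-! ### §F The elimination loop -/

/-- The inverse of an odd residue: `c · oddInv (K+1) c ≡ 1 (mod 2^(K+1))` (Euler). [folklore] -/
theorem mul_oddInv_mod {K c : ℕ} (hc : c % 2 = 1) : c * oddInv (K + 1) c % 2 ^ (K + 1) = 1 := by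
  have hcop : Nat.Coprime c (2 ^ (K + 1)) :=
    (Nat.coprime_pow_right_iff (Nat.succ_pos K) c 2).2 (Nat.coprime_two_right.2 (Nat.odd_iff.2 hc))
  have heuler := Nat.ModEq.pow_totient hcop
  rw [Nat.totient_prime_pow_succ Nat.prime_two, show 2 - 1 = 1 from rfl, mul_one] at heuler
  rw [oddInv, Nat.add_sub_cancel, Nat.mul_mod, Nat.mod_mod, ← Nat.mul_mod, ← pow_succ',
    Nat.sub_add_cancel (Nat.one_le_two_pow), heuler]
  exact Nat.one_mod_eq_one.2 (Nat.one_lt_two_pow (Nat.succ_ne_zero K)).ne'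

/-- The residue `(N - x % N) % N` is a negative of `x`: `x + (N - x % N)` is a multiple of `N`. [folklore] -/
theorem add_neg_mod {N : ℕ} (hN : 0 < N) (x : ℕ) : (x + (N - x % N)) % N = 0 := by
  have h1 : x % N ≤ N := (Nat.mod_lt x hN).le
  have h2 : x + (N - x % N) = N * (x / N + 1) := by
    have := Nat.div_add_mod x N
    rw [Nat.mul_add, Nat.mul_one]; omega
  rw [h2, Nat.mul_mod_right]

/-- The column-`0` entry of a row of `matOf` is the head of the row. [folklore] -/
theorem matOf_col_zero {m c : ℕ} (L : List (List ℕ)) (i : Fin m) :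
    matOf m (c + 1) L i 0 = (L.getD i []).headD 0 := by
  rw [matOf_apply]; cases L.getD i [] <;> rfl

/-- The head of `addRow`. [folklore] -/
theorem headD_addRow {N d : ℕ} {r q : List ℕ} (hr : 0 < r.length) (hq : 0 < q.length) :
    (addRow N d r q).headD 0 = (r.headD 0 + d * q.headD 0) % N := by
  cases r with
  | nil => simp at hr
  | cons x r => cases q with
    | nil => simp at hq
    | cons y q => rfl

/-- **The eliminated row starts with `0`**: with `d = -r₀·u` and `u·q₀ ≡ 1`, the column-`0` entry
`(r₀ + d·q₀) mod N` of `addRow N d r q` vanishes. [cite: Valiant1979, Thm. 3 (proof)] -/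
theorem headD_addRow_eq_zero {N u : ℕ} {r q : List ℕ} (hN : 0 < N) (hqu : q.headD 0 * u % N = 1 % N)
    (hr : 0 < r.length) (hq : 0 < q.length) :
    (addRow N ((N - r.headD 0 * u % N) % N) r q).headD 0 = 0 := by
  rw [headD_addRow hr hq]
  set r₀ := r.headD 0
  set q₀ := q.headD 0
  -- work in `ZMod N`
  have hcast : ((r₀ + (N - r₀ * u % N) % N * q₀ : ℕ) : ZMod N) = 0 := by
    have hle : r₀ * u % N ≤ N := (Nat.mod_lt _ hN).le
    have hneg : (((N - r₀ * u % N) % N : ℕ) : ZMod N) = -((r₀ * u : ℕ) : ZMod N) := by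
      rw [ZMod.natCast_mod, Nat.cast_sub hle, ZMod.natCast_self, zero_sub, ← ZMod.natCast_mod (r₀ * u) N]
    have hone : ((q₀ * u : ℕ) : ZMod N) = 1 := by
      rw [← ZMod.natCast_mod, hqu, ZMod.natCast_mod, Nat.cast_one]
    push_cast at hneg hone ⊢
    rw [hneg]
    linear_combination (-(r₀ : ZMod N)) * hone
  exact Nat.mod_eq_zero_of_dvd ((ZMod.natCast_eq_zero_iff _ _).1 hcast)

/-- All rows start with `0`. [folklore] -/
def Heads0 (done : List (List ℕ)) : Prop := ∀ row ∈ done, row.headD 0 = 0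

/-- **Specification of the elimination loop** (level `K+1`, prev correct modulo `2^K` on
`n × n` inputs, `u` an inverse of the pivot `q₀`): the output rows are well formed and start with
`0`, and `perm(current matrix) + corr` is invariant modulo `2^(K+1)`. [cite: Valiant1979, Thm. 3 (proof)] -/
theorem elim_spec {K n : ℕ} {prev : List (List ℕ) → ℕ}
    (hprev : ∀ L, WF n n L → prev L % 2 ^ K = (matOf n n L).permanent % 2 ^ K)
    (q : List ℕ) (u : ℕ) (hqu : q.headD 0 * u % 2 ^ (K + 1) = 1 % 2 ^ (K + 1)) :
    ∀ (todo done : List (List ℕ)) (corr : ℕ),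
      WF (n + 2) (n + 2) (q :: (done ++ todo)) → Heads0 done →
      WF (n + 2) (n + 2) (q :: (elim (K + 1) prev q u done todo corr).1) ∧
        Heads0 (elim (K + 1) prev q u done todo corr).1 ∧
        ((matOf (n + 2) (n + 2) (q :: (elim (K + 1) prev q u done todo corr).1)).permanent +
            (elim (K + 1) prev q u done todo corr).2) % 2 ^ (K + 1) =
          ((matOf (n + 2) (n + 2) (q :: (done ++ todo))).permanent + corr) % 2 ^ (K + 1) := by
  intro todo
  induction todo with
  | nil => intro done corr hwf hh; simpa using And.intro hwf hh
  | cons r rest ih =>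
    intro done corr hwf hh
    rw [elim_cons]
    set N := 2 ^ (K + 1) with hN
    set d := (N - r.headD 0 * u % N) % N with hd
    set X := pairSum q (fun b b' => prev (colMinor2 b b' (done ++ rest))) with hX
    set r' := addRow N d r q with hr'
    have hq : q.length = n + 2 := hwf.2 q (by simp)
    have hr : r.length = n + 2 := hwf.2 r (by simp)
    have hwf' : WF (n + 2) (n + 2) (q :: ((done ++ [r']) ++ rest)) := by
      refine ⟨by simpa using hwf.1, fun row hrow => ?_⟩
      simp only [List.append_assoc, List.singleton_append, List.mem_cons, List.mem_append] at hrow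
      rcases hrow with rfl | h | rfl | h
      · exact hq
      · exact hwf.2 row (by simp [h])
      · exact length_addRow hr hq
      · exact hwf.2 row (by simp [h])
    have hh' : Heads0 (done ++ [r']) := by
      intro row hrow
      rw [List.mem_append, List.mem_singleton] at hrow
      rcases hrow with h | rfl
      · exact hh row h
      · exact headD_addRow_eq_zero (Nat.two_pow_pos _) hqu (by omega) (by omega)
    obtain ⟨h1, h2, h3⟩ := ih (done ++ [r']) ((corr + (N - 2 * d * X % N)) % N) hwf' hh'
    refine ⟨h1, h2, ?_⟩
    rw [h3, List.append_assoc, List.singleton_append, Nat.add_mod, perm_elim_step hprev q r done rest hwf d,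
      ← hX, Nat.mod_mod, ← Nat.add_mod, add_assoc, Nat.add_mod, show 2 * d * X + (corr + (N - 2 * d * X % N)) =
        corr + (2 * d * X + (N - 2 * d * X % N)) by ring, Nat.add_mod corr, add_neg_mod (Nat.two_pow_pos _), add_zero, Nat.mod_mod,
      ← Nat.add_mod]

/-! ### §G Expansion along the cleared column, and the all-even column -/

/-- **Laplace at `(0, 0)` after elimination**: if every row below the pivot row `q` starts with `0`,
the permanent is `q₀ · perm(rows below, first column dropped)`. [cite: Valiant1979, Thm. 3 (proof)] -/
theorem perm_cons_of_heads0 {n : ℕ} (q : List ℕ) (done : List (List ℕ)) (hh : Heads0 done) :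
    (matOf (n + 1) (n + 1) (q :: done)).permanent =
      q.headD 0 * (matOf n n (done.map List.tail)).permanent := by
  rw [_root_.Matrix.permanent_eq_sum_column _ 0, Fin.sum_univ_succ, Fin.succAbove_zero, ← matOf_map_tail,
    Finset.sum_eq_zero fun i _ => ?_, add_zero]
  · rw [matOf_col_zero]; rfl
  · have h0 : matOf (n + 1) (n + 1) (q :: done) i.succ 0 = (done.getD i []).headD 0 := by
      rw [matOf_col_zero, Fin.val_succ, List.getD_cons_succ]
    rw [h0, List.getD_eq_getElem?_getD]
    cases h : done[(i : ℕ)]? with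
    | none => simp
    | some row => rw [Option.getD_some, hh row (List.mem_of_getElem? h), zero_mul]

/-- Rows of a well-formed matrix minus one, first column dropped, are well formed. [folklore] -/
theorem wf_minor0 {n : ℕ} {B : List (List ℕ)} (hwf : WF (n + 1) (n + 1) B) (a : Fin (n + 1)) :
    WF n n (minor0 a B) := by
  refine ⟨?_, fun row hrow => ?_⟩
  · rw [minor0, List.length_map, length_eraseIdx_of_lt hwf.1 a.isLt]
  · simp only [minor0, List.mem_map] at hrow
    obtain ⟨row₀, hmem, rfl⟩ := hrow
    rw [List.length_tail, hwf.2 row₀ (List.mem_of_mem_eraseIdx hmem)]; rfl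

/-- **A column without odd entries**: the permanent is `evenCorr` modulo `2^(K+1)` (Laplace along
column `0`; each coefficient is `2·(c_a/2)`, so the minors are needed only modulo `2^K`).
[cite: Valiant1979, Thm. 3 (proof)] -/
theorem perm_even_column {K n : ℕ} {prev : List (List ℕ) → ℕ}
    (hprev : ∀ L, WF n n L → prev L % 2 ^ K = (matOf n n L).permanent % 2 ^ K)
    (B : List (List ℕ)) (hwf : WF (n + 1) (n + 1) B) (heven : ∀ a : ℕ, (B.getD a []).headD 0 % 2 = 0) :
    (matOf (n + 1) (n + 1) B).permanent % 2 ^ (K + 1) = evenCorr (K + 1) prev B := by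
  rw [evenCorr, hwf.1, sum_map_range, _root_.Matrix.permanent_eq_sum_column _ 0]
  -- both sides as `2 · Σ`
  have hL : (∑ i : Fin (n + 1), matOf (n + 1) (n + 1) B i 0 *
      ((matOf (n + 1) (n + 1) B).submatrix i.succAbove (0 : Fin (n + 1)).succAbove).permanent) =
      2 * ∑ a ∈ Finset.range (n + 1), (B.getD a []).headD 0 / 2 * (matOf n n (minor0 a B)).permanent := by
    rw [Finset.mul_sum, ← Fin.sum_univ_eq_sum_range (fun a => 2 * ((B.getD a []).headD 0 / 2 *
      (matOf n n (minor0 a B)).permanent)) (n + 1)]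
    refine Finset.sum_congr rfl fun i _ => ?_
    rw [Fin.succAbove_zero, ← matOf_minor0, matOf_col_zero, ← mul_assoc,
      Nat.mul_div_cancel' (Nat.dvd_of_mod_eq_zero (heven i))]
  rw [hL]
  apply two_mul_mod_two_pow_succ
  rw [Finset.sum_nat_mod]
  conv_rhs => rw [Finset.sum_nat_mod]
  congr 1
  refine Finset.sum_congr rfl fun a ha => ?_
  rw [Nat.mul_mod, ← hprev _ (wf_minor0 hwf ⟨a, Finset.mem_range.1 ha⟩), ← Nat.mul_mod]

/-! ### §H One stage -/

/-- `stage` fixes a state with an empty matrix. [folklore] -/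
theorem stage_of_nil (K : ℕ) (prev : List (List ℕ) → ℕ) {st : List (List ℕ) × ℕ × ℕ} (h : st.1 = []) :
    stage K prev st = st := by
  obtain ⟨B, μ, acc⟩ := st
  simp only at h
  subst h
  rfl

/-- A fold of stages fixes a state with an empty matrix. [folklore] -/
theorem foldl_stage_of_nil (K : ℕ) (prev : List (List ℕ) → ℕ) (l : List ℕ) {st : List (List ℕ) × ℕ × ℕ}
    (h : st.1 = []) : l.foldl (fun st _ => stage K prev st) st = st := by
  induction l generalizing st with
  | nil => rfl
  | cons _ l ih => rw [List.foldl_cons, stage_of_nil K prev h, ih h]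

/-- The permanent of the `0 × 0` reading is `1`. [folklore] -/
theorem permanent_matOf_zero (L : List (List ℕ)) : (matOf 0 0 L).permanent = 1 :=
  _root_.Matrix.permanent_isEmpty

/-- **Specification of one stage** (level `K+1`, `prev` correct modulo `2^K` at every size): the
invariant `μ·perm(B) + acc (mod 2^(K+1))` is preserved, `B` stays well formed, and shrinks unless it
is already empty. [cite: Valiant1979, Thm. 3 (proof)] -/
theorem stage_spec {K m : ℕ} {prev : List (List ℕ) → ℕ}
    (hprev : ∀ n L, WF n n L → prev L % 2 ^ K = (matOf n n L).permanent % 2 ^ K)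
    (B : List (List ℕ)) (μ acc : ℕ) (hwf : WF m m B) :
    ∃ m', WF m' m' (stage (K + 1) prev (B, μ, acc)).1 ∧
      ((stage (K + 1) prev (B, μ, acc)).1.length < B.length ∨ B = []) ∧
      ((stage (K + 1) prev (B, μ, acc)).2.1 * (matOf m' m' (stage (K + 1) prev (B, μ, acc)).1).permanent +
          (stage (K + 1) prev (B, μ, acc)).2.2) % 2 ^ (K + 1) =
        (μ * (matOf m m B).permanent + acc) % 2 ^ (K + 1) := by
  haveI : NeZero (2 ^ (K + 1)) := ⟨(Nat.two_pow_pos _).ne'⟩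
  cases B with
  | nil => exact ⟨m, hwf, Or.inr rfl, rfl⟩
  | cons r B' =>
    obtain ⟨n, rfl⟩ : ∃ n, m = n + 1 := ⟨B'.length, by simpa using hwf.1.symm⟩
    rw [stage_cons]
    cases hodd : firstOdd ((r :: B').map fun r => r.headD 0) with
    | none =>
      refine ⟨0, ⟨rfl, by simp⟩, Or.inl (by simp), ?_⟩
      have heven : ∀ a : ℕ, ((r :: B').getD a []).headD 0 % 2 = 0 := fun a => by
        rw [← getD_heads]; exact firstOdd_none hodd a
      have hP := perm_even_column (hprev n) (r :: B') hwf heven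
      have hP' : (((matOf (n + 1) (n + 1) (r :: B')).permanent : ℕ) : ZMod (2 ^ (K + 1))) =
          ((evenCorr (K + 1) prev (r :: B') : ℕ) : ZMod (2 ^ (K + 1))) := by
        rw [ZMod.natCast_eq_natCast_iff', hP, evenCorr, Nat.mod_mod]
      show (0 * (matOf 0 0 []).permanent + (acc + μ * evenCorr (K + 1) prev (r :: B')) % 2 ^ (K + 1)) %
          2 ^ (K + 1) = (μ * (matOf (n + 1) (n + 1) (r :: B')).permanent + acc) % 2 ^ (K + 1)
      rw [← ZMod.natCast_eq_natCast_iff']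
      push_cast [ZMod.natCast_mod]
      rw [hP']
      ring
    | some p =>
      obtain ⟨hp, hc⟩ := firstOdd_some hodd
      rw [List.length_map] at hp
      rw [getD_heads] at hc
      have hp' : p < n + 1 := hwf.1 ▸ hp
      set q := (r :: B').getD p [] with hq
      set c := q.headD 0 with hcdef
      have hqmem : q ∈ r :: B' := by
        rw [hq, List.getD_eq_getElem?_getD, List.getElem?_eq_getElem hp]; exact List.getElem_mem hp
      have hqlen : q.length = n + 1 := hwf.2 q hqmem
      have hqu : q.headD 0 * oddInv (K + 1) c % 2 ^ (K + 1) = 1 % 2 ^ (K + 1) := by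
        rw [← hcdef, mul_oddInv_mod hc]
        exact (Nat.one_mod_eq_one.2 (Nat.one_lt_two_pow (Nat.succ_ne_zero K)).ne').symm
      -- moving the pivot row to the front does not change the permanent
      have hperm : (matOf (n + 1) (n + 1) (r :: B')).permanent =
          (matOf (n + 1) (n + 1) (q :: (r :: B').eraseIdx p)).permanent := by
        rw [hq, show p = ((⟨p, hp'⟩ : Fin (n + 1)) : ℕ) from rfl, matOf_cons_eraseIdx,
          _root_.Matrix.permanent_permute_cols]
      cases n with
      | zero =>
        -- a `1 × 1` matrix: `B = [q]`, nothing to eliminate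
        have hB' : B' = [] := by simpa using hwf.1
        subst hB'
        have hp0 : p = 0 := by omega
        subst hp0
        refine ⟨0, ⟨rfl, by simp⟩, Or.inl (by simp), ?_⟩
        show (μ * c % 2 ^ (K + 1) * (matOf 0 0 ((elim (K + 1) prev q (oddInv (K + 1) c) [] [] 0).1.map
            List.tail)).permanent + (acc + μ * (elim (K + 1) prev q (oddInv (K + 1) c) [] [] 0).2) %
              2 ^ (K + 1)) % 2 ^ (K + 1) = (μ * (matOf 1 1 [r]).permanent + acc) % 2 ^ (K + 1)
        rw [elim_nil, List.map_nil, permanent_matOf_zero, mul_one, mul_zero, add_zero,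
          _root_.Matrix.permanent_eq_elem_of_card_eq_one (by simp) (0 : Fin 1), matOf_apply]
        have hc0 : c = ([r].getD ((0 : Fin 1) : ℕ) []).getD ((0 : Fin 1) : ℕ) 0 := by
          rw [hcdef, hq]; show r.headD 0 = r.getD 0 0; cases r <;> rfl
        rw [← hc0, ← ZMod.natCast_eq_natCast_iff']
        push_cast [ZMod.natCast_mod]
        ring
      | succ n' =>
        have hwfq : WF (n' + 2) (n' + 2) (q :: ([] ++ (r :: B').eraseIdx p)) := by
          refine ⟨?_, fun row hrow => ?_⟩
          · rw [List.nil_append, List.length_cons, length_eraseIdx_of_lt hwf.1 hp']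
          · rw [List.nil_append, List.mem_cons] at hrow
            rcases hrow with rfl | h
            · exact hqlen
            · exact hwf.2 row (List.mem_of_mem_eraseIdx h)
        obtain ⟨h1, h2, h3⟩ := elim_spec (hprev n') q (oddInv (K + 1) c) hqu ((r :: B').eraseIdx p) [] 0 hwfq
          (fun _ h => by simp at h)
        set E := elim (K + 1) prev q (oddInv (K + 1) c) [] ((r :: B').eraseIdx p) 0 with hE
        have hlap := perm_cons_of_heads0 (n := n' + 1) q E.1 h2
        have hlenE : E.1.length = n' + 1 := by simpa using h1.1
        refine ⟨n' + 1, ⟨by rw [List.length_map, hlenE], fun row hrow => ?_⟩, Or.inl ?_, ?_⟩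
        · rw [List.mem_map] at hrow
          obtain ⟨row₀, hmem, rfl⟩ := hrow
          rw [List.length_tail, h1.2 row₀ (List.mem_cons_of_mem _ hmem)]; rfl
        · show (E.1.map List.tail).length < (r :: B').length
          rw [List.length_map, hlenE, hwf.1]; exact Nat.lt_succ_self _
        · rw [List.nil_append, add_zero, hlap, ← hperm, ← hcdef] at h3
          show (μ * c % 2 ^ (K + 1) * (matOf (n' + 1) (n' + 1) (E.1.map List.tail)).permanent +
              (acc + μ * E.2) % 2 ^ (K + 1)) % 2 ^ (K + 1) =
            (μ * (matOf (n' + 1 + 1) (n' + 1 + 1) (r :: B')).permanent + acc) % 2 ^ (K + 1)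
          rw [← ZMod.natCast_eq_natCast_iff'] at h3 ⊢
          push_cast [ZMod.natCast_mod] at h3 ⊢
          linear_combination (μ : ZMod (2 ^ (K + 1))) * h3

/-! ### §I All stages, and the main theorem -/

/-- Entries of the entrywise-reduced list matrix. [folklore] -/
theorem matOf_map_mod (m N : ℕ) (L : List (List ℕ)) (i j : Fin m) :
    matOf m m (L.map fun r => r.map fun x => x % N) i j % N = matOf m m L i j % N := by
  rw [matOf_apply, matOf_apply, getD_map_rows _ rfl, List.getD_eq_getElem?_getD, List.getElem?_map,
    List.getD_eq_getElem?_getD (l := L.getD i [])]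
  cases (L.getD i [])[(j : ℕ)]? with
  | none => rfl
  | some x => exact Nat.mod_mod _ _

/-- The stage invariant along a fold: preserved, and the matrix is exhausted once the number of
remaining stages bounds its size. [cite: Valiant1979, Thm. 3 (proof)] -/
theorem foldl_stage_spec {K : ℕ} {prev : List (List ℕ) → ℕ}
    (hprev : ∀ n L, WF n n L → prev L % 2 ^ K = (matOf n n L).permanent % 2 ^ K) (P₀ : ℕ) :
    ∀ (l : List ℕ) (st : List (List ℕ) × ℕ × ℕ) (m : ℕ), WF m m st.1 → st.1.length ≤ l.length →
      (st.2.1 * (matOf m m st.1).permanent + st.2.2) % 2 ^ (K + 1) = P₀ % 2 ^ (K + 1) →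
      (l.foldl (fun st _ => stage (K + 1) prev st) st).1 = [] ∧
        ((l.foldl (fun st _ => stage (K + 1) prev st) st).2.1 +
            (l.foldl (fun st _ => stage (K + 1) prev st) st).2.2) % 2 ^ (K + 1) = P₀ % 2 ^ (K + 1) := by
  intro l
  induction l with
  | nil =>
    intro st m hwf hlen hinv
    have hnil : st.1 = [] := List.eq_nil_of_length_eq_zero (Nat.le_zero.1 hlen)
    have hm : m = 0 := by rw [← hwf.1, hnil]; rfl
    subst hm
    refine ⟨hnil, ?_⟩
    rwa [permanent_matOf_zero, mul_one] at hinv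
  | cons _ l ih =>
    intro st m hwf hlen hinv
    obtain ⟨B, μ, acc⟩ := st
    rw [List.foldl_cons]
    obtain ⟨m', hwf', hlt, hinv'⟩ := stage_spec hprev B μ acc hwf
    rcases hlt with hlt | hB
    · have hlen' : B.length ≤ l.length + 1 := hlen
      have hlt' : (stage (K + 1) prev (B, μ, acc)).1.length < B.length := hlt
      exact ih _ m' hwf' (by omega) (hinv'.trans hinv)
    · have hB' : B = [] := hB
      subst hB'
      have hm : m = 0 := hwf.1.symm
      subst hm
      rw [stage_nil, foldl_stage_of_nil (K + 1) prev l rfl]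
      refine ⟨rfl, ?_⟩
      rwa [permanent_matOf_zero, mul_one] at hinv

/-- **Specification of `stages`**: the matrix is exhausted and `μ + acc` is the permanent modulo
`2^(K+1)`. [cite: Valiant1979, Thm. 3 (proof)] -/
theorem stages_spec {K m : ℕ} {prev : List (List ℕ) → ℕ}
    (hprev : ∀ n L, WF n n L → prev L % 2 ^ K = (matOf n n L).permanent % 2 ^ K)
    (L : List (List ℕ)) (hwf : WF m m L) :
    ((stages (K + 1) prev L).2.1 + (stages (K + 1) prev L).2.2) % 2 ^ (K + 1) =
      (matOf m m L).permanent % 2 ^ (K + 1) := by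
  have hwf' : WF m m (L.map fun r => r.map fun x => x % 2 ^ (K + 1)) := by
    refine ⟨by rw [List.length_map, hwf.1], fun row hrow => ?_⟩
    rw [List.mem_map] at hrow
    obtain ⟨row₀, hmem, rfl⟩ := hrow
    rw [List.length_map, hwf.2 row₀ hmem]
  have hinit : (1 * (matOf m m (L.map fun r => r.map fun x => x % 2 ^ (K + 1))).permanent + 0) % 2 ^ (K + 1) =
      (matOf m m L).permanent % 2 ^ (K + 1) := by
    rw [one_mul, add_zero]
    exact permanent_mod_congr _ fun i j => matOf_map_mod m _ L i j
  exact (foldl_stage_spec hprev _ (List.range L.length) (_, 1, 0) m hwf'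
    (by rw [List.length_range, List.length_map]) hinit).2

/-- **`pm K` computes the permanent modulo `2^K`** on well-formed square list matrices.
[cite: Valiant1979, Thm. 3] -/
theorem pm_spec : ∀ (K m : ℕ) (L : List (List ℕ)), WF m m L →
    pm K L % 2 ^ K = (matOf m m L).permanent % 2 ^ K
  | 0, m, L, _ => by simp [Nat.mod_one]
  | K + 1, m, L, hwf => by
    rw [pm_succ, Nat.mod_mod]
    exact stages_spec (fun n L' hwf' => pm_spec K n L' hwf') L hwf

/-- **Valiant's theorem, algorithmic half: `pm K (rows M) = perm(M) mod 2^K`** for every square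
matrix of naturals. [cite: Valiant1979, Thm. 3] -/
theorem pm_rows {m : ℕ} (K : ℕ) (M : _root_.Matrix (Fin m) (Fin m) ℕ) :
    pm K (Berkowitz.rows M) = M.permanent % 2 ^ K := by
  rw [← Nat.mod_eq_of_lt (pm_lt_two_pow K (Berkowitz.rows M)), pm_spec K m _ (wf_rows M), matOf_rows]

end PermMod2

end Literature.LinearAlgebra.Matrix
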